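/-
Copyright (c) 2026 the pub-hodgecm-mathlib formalisation cell (harness21).  Prover seat hodgecm-mathlib-B-p14 (g37), 2026-09-01.  Road «S3-tree» (architect A-p16 (g30) A-128 «swap»),
brick T3′ «depth-zero κ-transfer», population (P-2) TYPE (2), row (R2²) «THE FREE ROW», organ [T2-b] «THE GOOD CLASS HAS `κ = (−1)^n`» — THE SEAM (S) between the operator currency of
★ [T2-a] `CyclicSelfDualLatticeTorsor` (F0P3b-p01 (g12)) over `E = L_w` and the eigenframe currency of ★ `RationalGoodVectorParity` (this seat) over the eigen-field `K = K₁`.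
Modelled on ★ O8a-4 `SplitTorusOrderCountTransport.image_map_setOf_good_eq` (A-p19 (g25)), with the base change `j : E →+* K` inserted.
-/
import Literature.NumberTheory.Automorphic.CyclicSelfDualLatticeTorsor     -- ★ [T2-a] p846xxx F0P3b-p01 (g12): `span_range_pow_mulVec_eq_span_range_transpose`, `isUnit_det_of_span_range_transpose_eq`
import Literature.NumberTheory.Automorphic.SplitTorusOrderCountTransport    -- ★ O8a-4 A-p19 (g25): brings ★ O8a-3 `isIntegralMatrix_gram_and_valuation_det_iff_good`, `formCongr_mul_diagonal_vandermonde`, `gram_cyclic_eq`, `span_range_transpose_eq_map_span_pow_mul`, ★ L1, ★ `span_range_transpose_eq_iff`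
import HarnessLib

/-!
# Rational self-dual cyclic lattices of a non-split torus element ↔ rational GOOD vectors over the eigen-field (Jacobowitz 1962 §7; Rogawski 1990 Lemma 4.9.3)

Topic `NumberTheory/Automorphic`; namespace `Literature.NumberTheory.Automorphic.SymmetricEigenframe`.  THEOREMS ONLY (no definition, no instance, no notation, no named fact, no
`sorry`).  TWO valued fields `E` (`[ValuativeRel E]`: the lattice side, `L_w`) and `K` (`[ValuativeRel K]`: the eigen-field, `K₁`) joined by a ring map `j : E →+* K` respecting
integrality, with involutions `σ` on `E`, `σK`, `ι` on `K`.  Cell `pub/hodgecm-mathlib` (D-0151), crux H413 = `stmt-HodgeConjecture-24833`; road «S3-tree», brick T3′ «depth-zero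
κ-transfer», P-2 row (R2²) «THE FREE ROW, TYPE (2)» (holder A-p19 (g26); architect A-p16 (g30) A-127∕A-128), organ **[T2-b]**, its SEAM (S) (design line 19:35Z): it joins
★ [T2-a] `ncard_setOf_selfDual_cyclic_eq_relIndex` ∕ `exists_units_of_mem` (whose hypothesis `hb₀` is «some `L(w)` is self-dual») to ★ [T2-b] CORE `exists_rational_good_iff_even`
(«a RATIONAL GOOD vector exists»).  HONEST LABEL: HC_CM is proved only modulo the 2 remaining named inputs (hLiu418 24832, h413 24833) until rung 0 closes; elementary lattice algebra
over ★ material, asserts nothing printed.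

THE MATHEMATICS.  `τ ∈ M₃(E)` (the one-place avatar `δ_w` of a type-(2) class) has over `K` the eigenframe `τ^K = P·diag(γ)·P⁻¹`, `P ∈ GL₃(K)` SYMMETRIC for the rationality involution
`ι` (`Fix ι = j(E)`): `ι` fixes column `0` of `P` and exchanges columns `1, 2`; so `P·a ∈ j(E)³` iff `a` is RATIONAL (`ι a₀ = a₀`, `a₂ = ι a₁`).  For `w ∈ E³` with `j∘w = P·a` the Krylov
matrix `K(w) = [w | τw | τ²w]` maps to `P·diag(a)·V(γ)` (★ O8a-3 §1), and its Gram matrix `ᵗ(σK(w))·J·K(w)` maps to `ᵗ(σ_K V)·diag(dᵢ aᵢ σ_K aᵢ)·V` (★ `formCongr_mul_diagonal_vandermonde`,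
`Gram(P) = diag(d)`).  Hence (★ L1 over `E` ∕ ★ O8a-3 over `K`, integrality read through `j`): «`L(w) := span_𝒪 {τ^k w}` is `Λ(u)` for some `u ∈ U(σ, J)`» ⟺ «`K(w) ∈ GL₃` with
unimodular Gram over `𝒪_E`» ⟺ «`a` is GOOD over `(K, 𝒪_K)`».  THE SEAM: **`(∃ w, ∃ u ∈ U(σ,J), L(w) = Λ(u)) ↔ (∃ a rational, GOOD a)`** (`exists_selfDual_cyclic_iff_exists_rational_good`);
with ★ [T2-b] CORE the right side is «`½·log|d₀| + n` even» = «`κ = (−1)^n`», and with ★ [T2-a] `exists_units_of_mem` the left side is its `∃ b₀, hb₀`.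

* §1 transfer along `j`: `isIntegralMatrix_map_iff`, `valuation_det_map_eq_one_iff`, `formCongr_map`, `krylov_map`, `krylov_eq_mul_of_mulVec_eq` (`K(w)^K = P·diag(a)·V`).
* §2 rationality of `P·a` for a symmetric frame: `forall_map_mulVec_eq_iff_rational`.
* §3 **`exists_rational_good_of_selfDual_cyclic`** (⟹), **`exists_selfDual_cyclic_of_rational_good`** (⟸), **`exists_selfDual_cyclic_iff_exists_rational_good`**.

## References
* [Jacobowitz1962] R. Jacobowitz, *Hermitian forms over local fields*, Amer. J. Math. 84 (1962), §4, §7 Thm. 7.1 (unimodular lattices via Gram matrices).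
* [Rogawski1990] J. D. Rogawski, *Automorphic Representations of Unitary Groups in Three Variables* (1990), §4.9 Lemma 4.9.3 p. 56 (the eigen-coordinate count).
* [Kottwitz1986] R. E. Kottwitz, *Base change for unit elements of Hecke algebras*, Compositio Math. 60 (1986), §3 (stable lattices of a torus element).
* [HornJohnson2013] R. A. Horn, C. R. Johnson, *Matrix Analysis*, 2nd ed. (2013), §0.9.11 (Vandermonde), §3.2.4 (Krylov ∕ cyclic vectors).
-/

set_option autoImplicit false

open Finset Matrix Polynomial
open scoped MatrixGroups ValuativeRel
open ValuativeRel

namespace Literature.NumberTheory.Automorphic.SymmetricEigenframe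

open Literature.NumberTheory.Automorphic Literature.NumberTheory.Automorphic.UnitaryGroup

/-! ## §1 Transfer of integrality, determinants, Gram matrices and Krylov matrices along `j : E →+* K` -/

section Transfer

variable {E K : Type*} [Field E] [ValuativeRel E] [Field K] [ValuativeRel K] {n : ℕ} (j : E →+* K)
  (hjO : ∀ x : E, j x ∈ 𝒪[K] ↔ x ∈ 𝒪[E])

include hjO in
/-- Integrality of an `E`-matrix can be read in `K` along an integrality-respecting `j`. [cite: Jacobowitz1962, §4] -/
theorem isIntegralMatrix_map_iff (M : Matrix (Fin n) (Fin n) E) : IsIntegralMatrix (M.map j) ↔ IsIntegralMatrix M := by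
  simp only [IsIntegralMatrix, Matrix.map_apply, hjO]

omit [ValuativeRel E] in
/-- `|y| = 1 ↔ y, y⁻¹ ∈ 𝒪` for `y ≠ 0`. [cite: Jacobowitz1962, §4] -/
theorem valuation_eq_one_iff_mem_and_inv_mem {y : K} (hy : y ≠ 0) : valuation K y = 1 ↔ y ∈ 𝒪[K] ∧ y⁻¹ ∈ 𝒪[K] := by
  rw [Valuation.mem_integer_iff, Valuation.mem_integer_iff, map_inv₀]
  constructor
  · intro h; rw [h, inv_one]; exact ⟨le_rfl, le_rfl⟩
  · rintro ⟨h1, h2⟩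
    have hpos : 0 < valuation K y := lt_of_le_of_ne zero_le (((Valuation.ne_zero_iff _).2 hy)).symm
    exact le_antisymm h1 ((inv_le_one₀ hpos).1 h2)

include hjO in
/-- `|j x|_K = 1 ↔ |x|_E = 1` for an integrality-respecting `j` (a unit is an integer with integer inverse). [cite: Jacobowitz1962, §4] -/
theorem valuation_map_eq_one_iff (x : E) : valuation K (j x) = 1 ↔ valuation E x = 1 := by
  by_cases hx : x = 0
  · subst hx; simp
  rw [valuation_eq_one_iff_mem_and_inv_mem ((map_ne_zero j).2 hx), valuation_eq_one_iff_mem_and_inv_mem hx, ← map_inv₀, hjO, hjO]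

omit [ValuativeRel E] [ValuativeRel K] in
/-- `formCongr` commutes with `j`: `(ᵗ(σg)·J·g).map j = ᵗ(σ_K (g.map j))·(J.map j)·(g.map j)` when `σ_K ∘ j = j ∘ σ`. [cite: Jacobowitz1962, §4] -/
theorem formCongr_map (σ : E →+* E) (σK : K →+* K) (hσj : ∀ x, σK (j x) = j (σ x)) (g : GL (Fin n) E) (J : Matrix (Fin n) (Fin n) E) :
    (formCongr σ g J).map j = formCongr σK (Matrix.GeneralLinearGroup.map j g) (J.map j) := by
  have hcomm : ((g : Matrix (Fin n) (Fin n) E).map σ).map j = (((g : Matrix (Fin n) (Fin n) E).map j)).map σK := by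
    ext a b; simp only [Matrix.map_apply, hσj]
  rw [formCongr, formCongr, Matrix.map_mul, Matrix.map_mul, Matrix.transpose_map, hcomm]
  rfl

omit [ValuativeRel E] [ValuativeRel K] in
/-- The Krylov matrix commutes with `j`: `[w | τw | …].map j = [jw | τ^K jw | …]`, `τ^K = τ.map j`. [cite: HornJohnson2013, §3.2.4] -/
theorem krylov_map (τ : Matrix (Fin n) (Fin n) E) (w : Fin n → E) :
    (Matrix.of fun i k : Fin n => ((τ ^ (k : ℕ)) *ᵥ w) i).map j = Matrix.of fun i k : Fin n => (((τ.map j) ^ (k : ℕ)) *ᵥ (j ∘ w)) i := by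
  ext i k
  rw [Matrix.map_apply, Matrix.of_apply, Matrix.of_apply, RingHom.map_mulVec, ← RingHom.mapMatrix_apply, map_pow, RingHom.mapMatrix_apply]

omit [ValuativeRel K] in
/-- **The Krylov matrix in the eigenframe**: if `τ^K = P·diag(γ)·P⁻¹` and `v = P·a` then `[v | τ^K v | (τ^K)² v | …] = P·(diag(a)·V(γ))`. [cite: HornJohnson2013, §0.9.11, §3.2.4] -/
theorem krylov_eq_mul_of_mulVec_eq (P : GL (Fin n) K) (γ a : Fin n → K) (τK : Matrix (Fin n) (Fin n) K)
    (hτ : τK = (P : Matrix (Fin n) (Fin n) K) * diagonal γ * ((P⁻¹ : GL (Fin n) K) : Matrix (Fin n) (Fin n) K)) (v : Fin n → K)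
    (hv : v = (P : Matrix (Fin n) (Fin n) K) *ᵥ a) :
    (Matrix.of fun i k : Fin n => ((τK ^ (k : ℕ)) *ᵥ v) i) = (P : Matrix (Fin n) (Fin n) K) * (diagonal a * vandermonde γ) := by
  ext i k
  rw [Matrix.of_apply, hτ, hv, mulVec_conj_diagonal_pow, ← transpose_mul_diagonal_vandermonde, Matrix.transpose_apply]

end Transfer

/-! ## §2 Rationality of `P·a` for a symmetric frame -/

section Rational

variable {K : Type*} [Field K] (ι : K →+* K)

/-- **`P·a` is `ι`-fixed iff `a` is RATIONAL** for a SYMMETRIC frame `P ∈ GL₃(K)` (`ι` fixes column `0`, exchanges columns `1, 2`) and an involution `ι`.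
[cite: Rogawski1990, §4.9 Lemma 4.9.3 p. 56] -/
theorem forall_map_mulVec_eq_iff_rational (hιι : ∀ y, ι (ι y) = y) (P : GL (Fin 3) K)
    (hP0 : ∀ i, ι ((P : Matrix (Fin 3) (Fin 3) K) i 0) = (P : Matrix (Fin 3) (Fin 3) K) i 0)
    (hP1 : ∀ i, ι ((P : Matrix (Fin 3) (Fin 3) K) i 1) = (P : Matrix (Fin 3) (Fin 3) K) i 2)
    (hP2 : ∀ i, ι ((P : Matrix (Fin 3) (Fin 3) K) i 2) = (P : Matrix (Fin 3) (Fin 3) K) i 1) (a : Fin 3 → K) :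
    (∀ i, ι (((P : Matrix (Fin 3) (Fin 3) K) *ᵥ a) i) = ((P : Matrix (Fin 3) (Fin 3) K) *ᵥ a) i) ↔ (ι (a 0) = a 0 ∧ a 2 = ι (a 1)) := by
  -- `ι (P a) = P (S ι a)` with `S` the swap of the coordinates `1, 2`
  have hkey : ∀ i, ι (((P : Matrix (Fin 3) (Fin 3) K) *ᵥ a) i) = ((P : Matrix (Fin 3) (Fin 3) K) *ᵥ ![ι (a 0), ι (a 2), ι (a 1)]) i := by
    intro i
    simp only [Matrix.mulVec, dotProduct, Fin.sum_univ_three, map_add, map_mul, hP0, hP1, hP2, Matrix.cons_val_zero, Matrix.cons_val_one,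
      Matrix.cons_val]
    ring
  constructor
  · intro h
    have hvec : (P : Matrix (Fin 3) (Fin 3) K) *ᵥ ![ι (a 0), ι (a 2), ι (a 1)] = (P : Matrix (Fin 3) (Fin 3) K) *ᵥ a := funext fun i => by rw [← hkey i, h i]
    have hinj : Function.Injective ((P : Matrix (Fin 3) (Fin 3) K).mulVec) :=
      Matrix.mulVec_injective_of_isUnit P.isUnit
    have ha := hinj hvec
    have h0 := congrFun ha 0
    have h1 := congrFun ha 1
    simp only [Matrix.cons_val_zero, Matrix.cons_val_one] at h0 h1
    exact ⟨h0, by rw [← h1, hιι]⟩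
  · rintro ⟨h0, h2⟩ i
    rw [hkey i]
    congr 2
    funext k
    fin_cases k
    · exact h0
    · show ι (a 2) = a 1
      rw [h2, hιι]
    · show ι (a 1) = a 2
      rw [h2]

end Rational

/-! ## §3 The seam: self-dual rational cyclic lattices ↔ rational GOOD vectors -/

section Seam

variable {E K : Type*} [Field E] [ValuativeRel E] [Field K] [ValuativeRel K]
  (σ : E →+* E) (hσσ : ∀ x, σ (σ x) = x) (hσO : ∀ x : 𝒪[E], σ x ∈ 𝒪[E])
  (htr : ∃ b : 𝒪[E], (b : E) + σ b = 1) (hnorm : ∀ u : 𝒪[E], IsUnit u → σ u = u → ∃ t : 𝒪[E], (t : E) * σ t = u)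
  (J : GL (Fin 3) E) (hJ : J ∈ glInt 3 E) (hJh : ((J : Matrix (Fin 3) (Fin 3) E).map σ)ᵀ = J) (τ : Matrix (Fin 3) (Fin 3) E)
  (j : E →+* K) (hjO : ∀ x : E, j x ∈ 𝒪[K] ↔ x ∈ 𝒪[E]) (σK : K →+* K) (hσj : ∀ x, σK (j x) = j (σ x)) (hσKv : ∀ y, valuation K (σK y) = valuation K y)
  (ι : K →+* K) (hιι : ∀ y, ι (ι y) = y) (hιj : ∀ y, ι y = y ↔ ∃ x, j x = y)
  (P : GL (Fin 3) K) {γ d : Fin 3 → K}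
  (hτ : τ.map j = (P : Matrix (Fin 3) (Fin 3) K) * diagonal γ * ((P⁻¹ : GL (Fin 3) K) : Matrix (Fin 3) (Fin 3) K))
  (hP : formCongr σK P ((J : Matrix (Fin 3) (Fin 3) E).map j) = diagonal d)
  (hP0 : ∀ i, ι ((P : Matrix (Fin 3) (Fin 3) K) i 0) = (P : Matrix (Fin 3) (Fin 3) K) i 0)
  (hP1 : ∀ i, ι ((P : Matrix (Fin 3) (Fin 3) K) i 1) = (P : Matrix (Fin 3) (Fin 3) K) i 2)
  (hP2 : ∀ i, ι ((P : Matrix (Fin 3) (Fin 3) K) i 2) = (P : Matrix (Fin 3) (Fin 3) K) i 1)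
  (hγ : ∀ i, γ i ∈ 𝒪[K]) (hinj : Function.Injective γ) (hσγ : ∀ i, σK (γ i) = (γ i)⁻¹)
  {r : (𝒪[K])[X]} (hr : ∀ i, (r.map (𝒪[K]).subtype).eval (γ i) * γ i = 1)

omit [ValuativeRel E] [ValuativeRel K] in
include hP in
/-- The Gram matrix of `P·(diag(a)·V)` over `K` in the `Matrix.of ∑` form of ★ O8a-3. [cite: Jacobowitz1962, §4] -/
theorem formCongr_mul_eq_gram_sum (a : Fin 3 → K) (Ma : GL (Fin 3) K) (hMa : (Ma : Matrix (Fin 3) (Fin 3) K) = diagonal a * vandermonde γ) :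
    formCongr σK (P * Ma) ((J : Matrix (Fin 3) (Fin 3) E).map j) = Matrix.of fun p q : Fin 3 => ∑ i, (d i * a i * σK (a i)) * σK (γ i) ^ (p : ℕ) * γ i ^ (q : ℕ) := by
  rw [formCongr_mul_diagonal_vandermonde σK P ((J : Matrix (Fin 3) (Fin 3) E).map j) d hP a γ Ma hMa, gram_cyclic_eq]

include hjO hσj hτ hP hP0 hP1 hP2 hιj hιι hσσ hσO htr hnorm hJ hJh hσKv hγ hinj hσγ hr in
/-- **(⟹) A SELF-DUAL RATIONAL CYCLIC LATTICE GIVES A RATIONAL GOOD VECTOR**: if `L(w) = Λ(u)` for some `w ∈ E³`, `u ∈ U(σ,J)`, then `a := P⁻¹·(j∘w)` is rational and GOOD over `(K, 𝒪_K)`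
(★ L1 over `E`: the Gram matrix of `K(w)` is unimodular; read in `K` through `j` it is the eigenframe Gram `ᵗ(σ_K V)·diag(d a σ_K a)·V`; ★ O8a-3).
[cite: Jacobowitz1962, §7 Thm. 7.1] [cite: Rogawski1990, §4.9 Lemma 4.9.3 p. 56] [cite: Kottwitz1986, §3] -/
theorem exists_rational_good_of_selfDual_cyclic {w : Fin 3 → E}
    (hw : ∃ u ∈ unitaryGroupOfForm σ (J : Matrix (Fin 3) (Fin 3) E),
      Submodule.span 𝒪[E] (Set.range fun k : Fin 3 => (τ ^ (k : ℕ)) *ᵥ w) = Submodule.span 𝒪[E] (Set.range ((u : Matrix (Fin 3) (Fin 3) E))ᵀ)) :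
    ∃ a : Fin 3 → K, ι (a 0) = a 0 ∧ a 2 = ι (a 1) ∧
      ((fun i => d i * a i * σK (a i) * ∏ l ∈ univ.erase i, (γ i - γ l)) ∈ Submodule.span 𝒪[K] (Set.range fun k : Fin 3 => fun i => γ i ^ (k : ℕ)) ∧
        ∀ i, ∃ y ∈ 𝒪[K], y * (d i * a i * σK (a i) * ∏ l ∈ univ.erase i, (γ i - γ l)) = 1) := by
  classical
  obtain ⟨u, hu, hL⟩ := hw
  -- the Krylov matrix `K(w)` is invertible and `Λ(u) = Λ(K(w))`
  set Kw : Matrix (Fin 3) (Fin 3) E := Matrix.of fun i k : Fin 3 => ((τ ^ (k : ℕ)) *ᵥ w) i with hKw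
  have hΛ : Submodule.span 𝒪[E] (Set.range ((u : Matrix (Fin 3) (Fin 3) E))ᵀ) = Submodule.span 𝒪[E] (Set.range Kwᵀ) :=
    hL.symm.trans (span_range_pow_mulVec_eq_span_range_transpose τ w)
  have hKu : IsUnit Kw.det := isUnit_det_of_span_range_transpose_eq u Kw hΛ
  set g : GL (Fin 3) E := Matrix.GeneralLinearGroup.mkOfDetNeZero Kw hKu.ne_zero with hg
  have hgval : (g : Matrix (Fin 3) (Fin 3) E) = Kw := rfl
  -- unimodular Gram over `E`
  have hk : u⁻¹ * g ∈ glInt 3 E := (span_range_transpose_eq_iff u g).1 (by rw [hgval]; exact hΛ)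
  obtain ⟨J', hJ'int, hJ'val⟩ := (exists_mem_unitaryGroupOfForm_mul_iff σ hσσ hσO htr hnorm J hJ hJh g).1
    ⟨u, hu, u⁻¹ * g, hk, by rw [mul_inv_cancel_left]⟩
  have hintE : IsIntegralMatrix (formCongr σ g (J : Matrix (Fin 3) (Fin 3) E)) := by rw [← hJ'val]; exact isIntegralMatrix_of_mem_glInt hJ'int
  have hdetE : valuation E (formCongr σ g (J : Matrix (Fin 3) (Fin 3) E)).det = 1 := by rw [← hJ'val]; exact valuation_det_eq_one_of_mem_glInt hJ'int
  -- the coordinates `a = P⁻¹ (j ∘ w)` and the Krylov matrix over `K`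
  set a : Fin 3 → K := ((P⁻¹ : GL (Fin 3) K) : Matrix (Fin 3) (Fin 3) K) *ᵥ (j ∘ w) with ha
  have hPa : (P : Matrix (Fin 3) (Fin 3) K) *ᵥ a = j ∘ w := by
    rw [ha, mulVec_mulVec, ← Units.val_mul, mul_inv_cancel, Units.val_one, one_mulVec]
  have hKmap : Kw.map j = (P : Matrix (Fin 3) (Fin 3) K) * (diagonal a * vandermonde γ) := by
    rw [hKw, krylov_map, krylov_eq_mul_of_mulVec_eq P γ a (τ.map j) hτ (j ∘ w) hPa.symm]
  -- `diag(a)·V` is invertible: it is `P⁻¹ · K(w)^K`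
  have hdetMa : (diagonal a * vandermonde γ).det ≠ 0 := by
    have e : diagonal a * vandermonde γ = ((P⁻¹ : GL (Fin 3) K) : Matrix (Fin 3) (Fin 3) K) * Kw.map j := by
      rw [hKmap, ← Matrix.mul_assoc, ← Units.val_mul, inv_mul_cancel, Units.val_one, Matrix.one_mul]
    rw [e, Matrix.det_mul, ← RingHom.mapMatrix_apply, ← RingHom.map_det]
    exact mul_ne_zero (Matrix.isUnits_det_units _).ne_zero ((map_ne_zero j).2 hKu.ne_zero)
  set Ma : GL (Fin 3) K := Matrix.GeneralLinearGroup.mkOfDetNeZero _ hdetMa with hMa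
  have hMaval : (Ma : Matrix (Fin 3) (Fin 3) K) = diagonal a * vandermonde γ := rfl
  -- the Gram over `K`, read through `j`
  have hmapg : ((Matrix.GeneralLinearGroup.map j g : GL (Fin 3) K) : Matrix (Fin 3) (Fin 3) K) = ((P * Ma : GL (Fin 3) K) : Matrix (Fin 3) (Fin 3) K) := by
    rw [Units.val_mul, hMaval, ← hKmap]; rfl
  have hG : (formCongr σ g (J : Matrix (Fin 3) (Fin 3) E)).map j = formCongr σK (P * Ma) ((J : Matrix (Fin 3) (Fin 3) E).map j) := by
    rw [formCongr_map j σ σK hσj]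
    simp only [formCongr, hmapg]
  have hintK : IsIntegralMatrix (formCongr σK (P * Ma) ((J : Matrix (Fin 3) (Fin 3) E).map j)) := by
    rw [← hG]; exact (isIntegralMatrix_map_iff j hjO _).2 hintE
  have hdetK : valuation K (formCongr σK (P * Ma) ((J : Matrix (Fin 3) (Fin 3) E).map j)).det = 1 := by
    rw [← hG, ← RingHom.mapMatrix_apply, ← RingHom.map_det]; exact (valuation_map_eq_one_iff j hjO _).2 hdetE
  rw [formCongr_mul_eq_gram_sum J j σK P hP a Ma hMaval] at hintK hdetK
  obtain ⟨hmem, hunit⟩ := (isIntegralMatrix_gram_and_valuation_det_iff_good σK hσKv hγ hinj hσγ hr d a).1 ⟨hintK, hdetK⟩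
  -- rationality of `a`
  have hfix : ∀ i, ι (((P : Matrix (Fin 3) (Fin 3) K) *ᵥ a) i) = ((P : Matrix (Fin 3) (Fin 3) K) *ᵥ a) i := fun i => by
    rw [hPa]; exact (hιj _).2 ⟨w i, rfl⟩
  obtain ⟨h0, h2⟩ := (forall_map_mulVec_eq_iff_rational ι hιι P hP0 hP1 hP2 a).1 hfix
  exact ⟨a, h0, h2, hmem, hunit⟩

include hjO hσj hτ hP hP0 hP1 hP2 hιj hιι hσσ hσO htr hnorm hJ hJh hσKv hγ hinj hσγ hr in
/-- **(⟸) A RATIONAL GOOD VECTOR GIVES A SELF-DUAL RATIONAL CYCLIC LATTICE**: for `a` rational and GOOD, `P·a = j∘w` for some `w ∈ E³` (symmetric frame), the Gram of `K(w)` is unimodular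
over `𝒪_K` (★ O8a-3), hence over `𝒪_E` (read back through `j`), so `L(w) = Λ(u)` with `u ∈ U(σ,J)` (★ L1). [cite: Jacobowitz1962, §7 Thm. 7.1] [cite: Rogawski1990, §4.9 Lemma 4.9.3 p. 56]
[cite: Kottwitz1986, §3] -/
theorem exists_selfDual_cyclic_of_rational_good {a : Fin 3 → K} (ha0 : ι (a 0) = a 0) (ha2 : a 2 = ι (a 1))
    (hgood : ((fun i => d i * a i * σK (a i) * ∏ l ∈ univ.erase i, (γ i - γ l)) ∈ Submodule.span 𝒪[K] (Set.range fun k : Fin 3 => fun i => γ i ^ (k : ℕ)) ∧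
        ∀ i, ∃ y ∈ 𝒪[K], y * (d i * a i * σK (a i) * ∏ l ∈ univ.erase i, (γ i - γ l)) = 1)) :
    ∃ w : Fin 3 → E, ∃ u ∈ unitaryGroupOfForm σ (J : Matrix (Fin 3) (Fin 3) E),
      Submodule.span 𝒪[E] (Set.range fun k : Fin 3 => (τ ^ (k : ℕ)) *ᵥ w) = Submodule.span 𝒪[E] (Set.range ((u : Matrix (Fin 3) (Fin 3) E))ᵀ) := by
  classical
  obtain ⟨hmem, hunit⟩ := hgood
  have hane : ∀ i, a i ≠ 0 := fun i h0 => by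
    obtain ⟨y, -, hy⟩ := hunit i
    rw [h0] at hy
    simp at hy
  -- `P a` is rational: choose `w` with `j ∘ w = P a`
  have hfix := (forall_map_mulVec_eq_iff_rational ι hιι P hP0 hP1 hP2 a).2 ⟨ha0, ha2⟩
  choose w hw using fun i => (hιj _).1 (hfix i)
  have hPa : (P : Matrix (Fin 3) (Fin 3) K) *ᵥ a = j ∘ w := funext fun i => (hw i).symm
  -- the Krylov matrix of `w` over `K` is `P · diag(a) · V`
  set Kw : Matrix (Fin 3) (Fin 3) E := Matrix.of fun i k : Fin 3 => ((τ ^ (k : ℕ)) *ᵥ w) i with hKw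
  have hKmap : Kw.map j = (P : Matrix (Fin 3) (Fin 3) K) * (diagonal a * vandermonde γ) := by
    rw [hKw, krylov_map, krylov_eq_mul_of_mulVec_eq P γ a (τ.map j) hτ (j ∘ w) hPa.symm]
  have hdetMa : (diagonal a * vandermonde γ).det ≠ 0 := det_diagonal_mul_vandermonde_ne_zero hane hinj
  set Ma : GL (Fin 3) K := Matrix.GeneralLinearGroup.mkOfDetNeZero _ hdetMa with hMa
  have hMaval : (Ma : Matrix (Fin 3) (Fin 3) K) = diagonal a * vandermonde γ := rfl
  -- `K(w)` is invertible
  have hKu : Kw.det ≠ 0 := by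
    intro h0
    have h := congrArg j h0
    rw [RingHom.map_det, RingHom.mapMatrix_apply, hKmap, map_zero, Matrix.det_mul] at h
    exact mul_ne_zero (Matrix.isUnits_det_units P).ne_zero hdetMa h
  set g : GL (Fin 3) E := Matrix.GeneralLinearGroup.mkOfDetNeZero Kw hKu with hg
  have hgval : (g : Matrix (Fin 3) (Fin 3) E) = Kw := rfl
  -- unimodular Gram over `K` (★ O8a-3), read back to `E`
  obtain ⟨hintK, hdetK⟩ := (isIntegralMatrix_gram_and_valuation_det_iff_good σK hσKv hγ hinj hσγ hr d a).2 ⟨hmem, hunit⟩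
  rw [← formCongr_mul_eq_gram_sum J j σK P hP a Ma hMaval] at hintK hdetK
  have hmapg : ((Matrix.GeneralLinearGroup.map j g : GL (Fin 3) K) : Matrix (Fin 3) (Fin 3) K) = ((P * Ma : GL (Fin 3) K) : Matrix (Fin 3) (Fin 3) K) := by
    rw [Units.val_mul, hMaval, ← hKmap]; rfl
  have hG : (formCongr σ g (J : Matrix (Fin 3) (Fin 3) E)).map j = formCongr σK (P * Ma) ((J : Matrix (Fin 3) (Fin 3) E).map j) := by
    rw [formCongr_map j σ σK hσj]
    simp only [formCongr, hmapg]
  have hintE : IsIntegralMatrix (formCongr σ g (J : Matrix (Fin 3) (Fin 3) E)) := by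
    rw [← isIntegralMatrix_map_iff j hjO, hG]; exact hintK
  have hdetE : valuation E (formCongr σ g (J : Matrix (Fin 3) (Fin 3) E)).det = 1 := by
    rw [← valuation_map_eq_one_iff j hjO, RingHom.map_det, RingHom.mapMatrix_apply, hG]; exact hdetK
  have hdet0 : (formCongr σ g (J : Matrix (Fin 3) (Fin 3) E)).det ≠ 0 := fun h0 => by rw [h0, map_zero] at hdetE; exact zero_ne_one hdetE
  set J' : GL (Fin 3) E := Matrix.GeneralLinearGroup.mkOfDetNeZero _ hdet0 with hJ'
  have hJ'val : (J' : Matrix (Fin 3) (Fin 3) E) = formCongr σ g (J : Matrix (Fin 3) (Fin 3) E) := rfl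
  have hJ'int : J' ∈ glInt 3 E := mem_glInt_of_isIntegralMatrix (by rw [hJ'val]; exact hintE) (by rw [hJ'val]; exact hdetE)
  obtain ⟨u, hu, k, hk, hgk⟩ := (exists_mem_unitaryGroupOfForm_mul_iff σ hσσ hσO htr hnorm J hJ hJh g).2 ⟨J', hJ'int, hJ'val⟩
  refine ⟨w, u, hu, ?_⟩
  rw [span_range_pow_mulVec_eq_span_range_transpose]
  change Submodule.span 𝒪[E] (Set.range ((g : Matrix (Fin 3) (Fin 3) E))ᵀ) = _
  rw [eq_comm, span_range_transpose_eq_iff, hgk, inv_mul_cancel_left]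
  exact hk

include hjO hσj hτ hP hP0 hP1 hP2 hιj hιι hσσ hσO htr hnorm hJ hJh hσKv hγ hinj hσγ hr in
/-- **THE SEAM (S) OF ORGAN [T2-b]: «some rational `τ`-cyclic lattice `L(w) = span_𝒪{τ^k w}` is self-dual (`= Λ(u)`, `u ∈ U(σ,J)`)» — the hypothesis `hb₀` of ★ [T2-a]
`ncard_setOf_selfDual_cyclic_eq_relIndex` up to ★ `exists_units_of_mem` — holds iff «a RATIONAL GOOD vector exists» over the eigen-field — the left side of ★ [T2-b] CORE
`exists_rational_good_iff_even`.** [cite: Jacobowitz1962, §7 Thm. 7.1] [cite: Rogawski1990, §4.9 Lemma 4.9.3 p. 56] [cite: Kottwitz1986, §3] -/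
theorem exists_selfDual_cyclic_iff_exists_rational_good :
    (∃ w : Fin 3 → E, ∃ u ∈ unitaryGroupOfForm σ (J : Matrix (Fin 3) (Fin 3) E),
      Submodule.span 𝒪[E] (Set.range fun k : Fin 3 => (τ ^ (k : ℕ)) *ᵥ w) = Submodule.span 𝒪[E] (Set.range ((u : Matrix (Fin 3) (Fin 3) E))ᵀ)) ↔
    ∃ a : Fin 3 → K, ι (a 0) = a 0 ∧ a 2 = ι (a 1) ∧
      ((fun i => d i * a i * σK (a i) * ∏ l ∈ univ.erase i, (γ i - γ l)) ∈ Submodule.span 𝒪[K] (Set.range fun k : Fin 3 => fun i => γ i ^ (k : ℕ)) ∧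
        ∀ i, ∃ y ∈ 𝒪[K], y * (d i * a i * σK (a i) * ∏ l ∈ univ.erase i, (γ i - γ l)) = 1) := by
  constructor
  · rintro ⟨w, hw⟩
    exact exists_rational_good_of_selfDual_cyclic σ hσσ hσO htr hnorm J hJ hJh τ j hjO σK hσj hσKv ι hιι hιj P hτ hP hP0 hP1 hP2 hγ hinj hσγ hr hw
  · rintro ⟨a, ha0, ha2, hgood⟩
    exact exists_selfDual_cyclic_of_rational_good σ hσσ hσO htr hnorm J hJ hJh τ j hjO σK hσj hσKv ι hιι hιj P hτ hP hP0 hP1 hP2 hγ hinj hσγ hr ha0 ha2 hgood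

end Seam

end Literature.NumberTheory.Automorphic.SymmetricEigenframe
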